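import Literature.AlgebraicGeometry.Frobenioids.CharacteristicSplitting
import Literature.AlgebraicGeometry.Frobenioids.NaiveFrobeniusFunctorLifts
import HarnessLib

/-!
# [FrdI] Proposition 2.5 (iii) and Corollary 2.6: sub-lemmas (statements) — S-DAG W7

Mochizuki, *The geometry of Frobenioids I: the general theory*, Kyushu J. Math. **62** (2008)
293–400, §2, Proposition 2.5 (iii) (statement p. 48 l. 52 – p. 49 l. 9, proof p. 49 l. 21 – p. 50
l. 27) and Corollary 2.6 (statement p. 50 l. 32 – p. 51 l. 4, proof p. 51 ll. 5–17), kurims text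
[cite: MochizukiFrdI2008, Prop. 2.5(iii) p.49] [cite: MochizukiFrdI2008, Cor. 2.6 p.50].

STATEMENTS-ONLY file (D-0068 (1) "statements first"; sub-DAG `plan/L1/SUBDAG-FrdI-Prop25-Cor26.md`,
holder abc-iut-L1-t2 = typer of `CharacteristicSplitting.lean`): the printed PROOF of Prop. 2.5 (iii)
(construction of the unit-linear Frobenius functor `Ψ : C ⥲ C(d)` from the four-fold factorisation
`φ = α ∘ β ∘ γ ∘ δ` and the characteristic splitting `O^×(A) × τ(A) ⥲ O^▷(A)`) and of Cor. 2.6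
(`Ψ := Ψ₂ ∘ Ψ₁`) cut into named intermediate statements `P25.*`, each a `def … : Prop` over the LANDED
targets `PreFrobenioid.UnitLinearFrobeniusExists d`, `PreFrobenioid.CdIsFrobenioid d`,
`PreFrobenioid.UnitWiseFrobeniusExists d` (`CharacteristicSplitting.lean`, seat abc-iut-L1-t2) and
their vocabulary (`CharacteristicSplitting`, `divIn`, `Cd`, `cdToElem`, `UnitLinearFrobeniusData`;
`naiveFrobeniusOf` of Prop. 2.1, `NaiveFrobeniusFunctorLifts.lean`).  Nothing is asserted; slots
`…_holds` are for provers.  Typed case `Λ = ℤ` (`d : ℕ+`, "multiplication by `d`" = `powEnd Φ d`), as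
the landed targets — the `Λ = ℚ, ℝ` endomorphism is `realPowEnd` (`SupportsRealActionFunctor.lean`,
seat abc-iut-L1-d2); TODO(general form) recorded in `CharacteristicSplitting.lean`.

Rendering notes.  (1) Print's composition is `∘`; Lean's is diagrammatic: the printed
`φ = α ∘ β ∘ γ ∘ δ` ("`α` a pull-back morphism; `β` a base-identity pre-step endomorphism; `γ` an
isometric pre-step; `δ` a morphism of Frobenius type", p. 49) is `φ = δ ≫ γ ≫ β ≫ α`.  (2) Print
applies the splitting "even if `A` is not isotropic [cf. Definition 2.3, (a), (b)]" (p. 49 l. 33):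
`τ(A)` for arbitrary `A` is read through an isotropic hull `h : A → A^istr` — `β₁ ∈ O^▷(A)` "lies in
`τ`" iff its image under `O^▷(A) ↪ O^▷(A^istr)` (Prop. 2.2 (iv)) lies in `τ(A^istr)` (`InTauVia`); the
values `τ.τ A` of the structure at non-isotropic `A` are never used (as in `CharacteristicSplitting.lean`).
(3) `End A` multiplies by `f * g = g ≫ f`; `O^▷(A)` is commutative (Rem. 1.3.1), so the order in
`β = β₀ · β₁` is immaterial.  (4) Cor. 2.6's `Ψ` is fixed as THE composite `Ψ₁ ⋙ Ψ₂` of print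
(`Ψ₁` = the naive Frobenius functor factored through `C(d)`, `Ψ₂` = a quasi-inverse of the unit-linear
Frobenius functor), so rows (a)–(d) are statements about that functor.
No side is taken on [IUTchIII] Cor. 3.12; typed ≠ proved.
-/

noncomputable section

namespace Literature.AlgebraicGeometry.Frobenioids

open CategoryTheory Opposite

namespace FrdI.P25

open PreFrobenioid

universe w v v' u u'

variable {D : Type u} [Category.{v} D] {Φ : Dᵒᵖ ⥤ CommMonCat.{w}}
  {C : Type u'} [Category.{v'} C] (F : C ⥤ ElemFrobenioid Φ)

/-! ## The setting of Prop. 2.5 / Cor. 2.6 -/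

/-- The standing hypotheses of Prop. 2.5 and Cor. 2.6 (p. 48): `C → F_Φ` a Frobenioid of
Frobenius-normalized, metrically trivial and Aut-ample type.  (The characteristic splitting `τ` and
the degree `d` are separate parameters.) [cite: MochizukiFrdI2008, Prop. 2.5 p.48] -/
structure Setting : Prop where
  /-- `C` is a Frobenioid -/
  isFrobenioid : IsFrobenioid F
  /-- of Frobenius-normalized type -/
  frobeniusNormalized : IsOfType (IsFrobeniusNormalized F)
  /-- of metrically trivial type -/
  metricallyTrivial : IsOfType (IsMetricallyTrivial F)
  /-- of `Aut`-ample type -/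
  autAmple : IsOfType (IsAutAmple F)

/-! ## P25-L01, L02 — the four-fold factorisation (p. 49 ll. 21–29) -/

/-- A *four-fold factorisation* of `φ : A → B` (p. 49 ll. 21–26): `φ = α ∘ β ∘ γ ∘ δ` with `δ : A → X`
of Frobenius type, `γ : X → Y` an isometric pre-step, `β ∈ O^▷(Y)` a base-identity pre-step
endomorphism, `α : Y → B` a pull-back morphism (diagrammatically `δ ≫ γ ≫ β ≫ α = φ`).
[cite: MochizukiFrdI2008, Prop. 2.5(iii) p.49] -/
def IsFourFold {A B X Y : C} (φ : A ⟶ B) (δ : A ⟶ X) (γ : X ⟶ Y) (β : Y ⟶ Y) (α : Y ⟶ B) : Prop :=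
  IsFrobeniusType F δ ∧ (IsIsometry F γ ∧ IsPreStep F γ) ∧ β ∈ endSubmonoid F Y ∧
    IsPullbackMorphism F α ∧ δ ≫ γ ≫ β ≫ α = φ

/-- **P25-L01** `FourFoldFactorisation` (p. 49 ll. 21–26): "by applying the factorizations of
Definition 1.3, (iv), (a); (v), (c), together with the bijection of assertion (i) …, every morphism
`φ` of `C` admits a factorization `φ = α ∘ β ∘ γ ∘ δ`" as in `IsFourFold`.
[cite: MochizukiFrdI2008, Prop. 2.5(iii) p.49] -/
def FourFoldFactorisation : Prop :=
  Setting F → ∀ ⦃A B : C⦄ (φ : A ⟶ B),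
    ∃ (X Y : C) (δ : A ⟶ X) (γ : X ⟶ Y) (β : Y ⟶ Y) (α : Y ⟶ B), IsFourFold F φ δ γ β α

/-- **P25-L02** `FourFoldFactorisationUnique` (p. 49 ll. 26–29): "this factorization is unique, up to
replacing `(α, β, γ, δ)` by `(α ∘ ε, ε⁻¹ ∘ β ∘ ζ, ζ⁻¹ ∘ γ ∘ θ, θ⁻¹ ∘ δ)`, where `ε, θ` are isomorphisms
of `C`, and `ζ = β′ ∘ ε`, for some base-identity automorphism `β′`" (`β′ ∈ O^×`); diagrammatically,
with `θ : X′ ⥲ X`, `ε : Y′ ⥲ Y`, `u = β′ ∈ O^×(Y)`: `δ′ = δ ≫ θ⁻¹`, `γ′ = θ ≫ γ ≫ u⁻¹ ≫ ε⁻¹`,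
`β′… = (ε ≫ u) ≫ β ≫ ε⁻¹`, `α′ = ε ≫ α`. [cite: MochizukiFrdI2008, Prop. 2.5(iii) p.49] -/
def FourFoldFactorisationUnique : Prop :=
  Setting F → ∀ ⦃A B X Y X' Y' : C⦄ (φ : A ⟶ B) (δ : A ⟶ X) (γ : X ⟶ Y) (β : Y ⟶ Y) (α : Y ⟶ B)
    (δ' : A ⟶ X') (γ' : X' ⟶ Y') (β' : Y' ⟶ Y') (α' : Y' ⟶ B),
    IsFourFold F φ δ γ β α → IsFourFold F φ δ' γ' β' α' →
      ∃ (θ : X' ≅ X) (ε : Y' ≅ Y) (u : Aut Y), u ∈ unitsSubgroup F Y ∧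
        δ' = δ ≫ θ.inv ∧ γ' = θ.hom ≫ γ ≫ u.inv ≫ ε.inv ∧
          β' = (ε.hom ≫ u.hom) ≫ β ≫ ε.inv ∧ α' = ε.hom ≫ α

/-! ## P25-L03 — the splitting at an arbitrary object and `Ψ(β) := β₀ · β₁^d` (p. 49 l. 30 – p. 50 l. 2) -/

variable {F} in
/-- "`β₁ ∈ τ(A)`" for an ARBITRARY object `A`, read through an isotropic hull `h : A → A^istr` (Def. 2.3
(b); Prop. 2.2 (iv)): the image of `β₁ ∈ O^▷(A)` in `O^▷(A^istr)` — the unique `t` with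
`h ≫ t = β₁ ≫ h` — lies in `τ(A^istr)`. [cite: MochizukiFrdI2008, Def. 2.3 p.47] -/
def InTauVia (τ : CharacteristicSplitting F) {A A' : C} (h : A ⟶ A') (β₁ : A ⟶ A) : Prop :=
  ∃ t : A' ⟶ A', (t : End A') ∈ τ.τ A' ∧ h ≫ t = β₁ ≫ h

/-- **P25-L03** `SplittingAtAnyObject` (p. 49 ll. 32–37: "by applying the characteristic splitting
`O^×(A) × τ(A) ⥲ O^▷(A)` [which applies even if `A` is not isotropic — cf. Definition 2.3, (a), (b)] to
`β ∈ O^▷(A)`, we obtain a factorization `β = β₀ · β₁` [where `β₀ ∈ O^×(A)`, `β₁ ∈ τ(A)`]"): for every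
isotropic hull `h : A → A^istr` and `β ∈ O^▷(A)` there are UNIQUE `β₀ ∈ O^×(A)` and `β₁ ∈ O^▷(A)` "in
`τ` via `h`" with `β = β₀ ∘ β₁`. [cite: MochizukiFrdI2008, Prop. 2.5(iii) p.49] -/
def SplittingAtAnyObject (τ : CharacteristicSplitting F) : Prop :=
  Setting F → ∀ ⦃A A' : C⦄ (h : A ⟶ A'), IsIsotropicHull F h → ∀ β : A ⟶ A, (β : End A) ∈ endSubmonoid F A →
    ∃! p : Aut A × (A ⟶ A), p.1 ∈ unitsSubgroup F A ∧ (p.2 : End A) ∈ endSubmonoid F A ∧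
      InTauVia τ h p.2 ∧ β = p.2 ≫ p.1.hom

/-- **P25-L03′** `SplitPowEndo` (p. 49 l. 37 – p. 50 l. 2, p. 50 ll. 11–13: "we set `Ψ(β) := β₀ · β₁^d`
… the expression `β₁^d` makes sense …; the elementary computation `Ψ(β^{d′}) = Ψ(β)^{d′}`"): for every
isotropic hull `h : A → A^istr` there is a unique monoid endomorphism `Ψ_A` of `O^▷(A)` which is the
identity on `O^×(A)` and the `d`-th power on the elements in `τ` via `h`.
[cite: MochizukiFrdI2008, Prop. 2.5(iii) p.49] -/
def SplitPowEndo (τ : CharacteristicSplitting F) (d : ℕ+) : Prop :=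
  Setting F → ∀ ⦃A A' : C⦄ (h : A ⟶ A'), IsIsotropicHull F h →
    ∃! Ψ : endSubmonoid F A →* endSubmonoid F A,
      (∀ (u : Aut A) (hu : u ∈ unitsSubgroup F A), Ψ ⟨u.hom, hu⟩ = ⟨u.hom, hu⟩) ∧
      ∀ β : endSubmonoid F A, InTauVia τ h β.1 → Ψ β = β ^ (d : ℕ)

/-! ## P25-L04 – L06 — the assignment `φ ↦ Ψ(φ)` (p. 50 ll. 2–18) -/

variable {F} in
/-- "`ψ` is a value of `Ψ` at `φ`" for the construction of p. 49 l. 37: there are a four-fold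
factorisation `φ = α ∘ β ∘ γ ∘ δ`, an isotropic hull `h` of the middle object, the splitting
`β = β₀ ∘ β₁` of L03 and `ψ = α ∘ (β₀ ∘ β₁^d) ∘ γ ∘ δ` (diagrammatically
`ψ = δ ≫ γ ≫ (β₁^d ≫ β₀) ≫ α`). [cite: MochizukiFrdI2008, Prop. 2.5(iii) p.49] -/
def IsPsiValue (τ : CharacteristicSplitting F) (d : ℕ+) {A B : C} (φ ψ : A ⟶ B) : Prop :=
  ∃ (X Y Y' : C) (δ : A ⟶ X) (γ : X ⟶ Y) (β : Y ⟶ Y) (α : Y ⟶ B) (h : Y ⟶ Y') (β₀ : Aut Y)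
    (β₁ : Y ⟶ Y), IsFourFold F φ δ γ β α ∧ IsIsotropicHull F h ∧ β₀ ∈ unitsSubgroup F Y ∧
      (β₁ : End Y) ∈ endSubmonoid F Y ∧ InTauVia τ h β₁ ∧ β = β₁ ≫ β₀.hom ∧
        ψ = δ ≫ γ ≫ ((show End Y from β₁) ^ (d : ℕ) : End Y) ≫ β₀.hom ≫ α

/-- **P25-L04** `PsiMapWellDefined` (p. 50 ll. 2–6: "it follows immediately from the functoriality of
the characteristic splitting `τ(−)` that … `Ψ(ε⁻¹ ∘ β ∘ β′ ∘ ε) = ε⁻¹ ∘ Ψ(β) ∘ β′ ∘ ε`.  This implies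
immediately that `Ψ(φ)` is independent of the choice of factorization"): every `φ` has exactly one
`Ψ`-value. [cite: MochizukiFrdI2008, Prop. 2.5(iii) p.50] -/
def PsiMapWellDefined (τ : CharacteristicSplitting F) (d : ℕ+) : Prop :=
  Setting F → ∀ ⦃A B : C⦄ (φ : A ⟶ B), ∃! ψ : A ⟶ B, IsPsiValue τ d φ ψ

/-- **P25-L05** `PsiCompIstr` (p. 50 ll. 7–14: "by assertion (ii) … the morphism of Frobenius type `δ`
may be taken to be a base-identity endomorphism.  Thus, by the functoriality of `τ` with respect to
morphisms of `(C^istr)^lin`, and our assumption that `C` is of Frobenius-normalized type — together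
with … `Ψ(β^{d′}) = Ψ(β)^{d′}` … — the assignment `φ ↦ Ψ(φ)` is compatible with composites, at least
when `φ ∈ Arr(C^istr)`"): `Ψ`-values compose for arrows between ISOTROPIC objects.
[cite: MochizukiFrdI2008, Prop. 2.5(iii) p.50] -/
def PsiCompIstr (τ : CharacteristicSplitting F) (d : ℕ+) : Prop :=
  Setting F → ∀ ⦃X Y Z : C⦄, IsIsotropic F X → IsIsotropic F Y → IsIsotropic F Z →
    ∀ (φ : X ⟶ Y) (ψ : Y ⟶ Z) (φ' : X ⟶ Y) (ψ' : Y ⟶ Z),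
      IsPsiValue τ d φ φ' → IsPsiValue τ d ψ ψ' → IsPsiValue τ d (φ ≫ ψ) (φ' ≫ ψ')

/-- **P25-L06** `PsiComp` (p. 50 ll. 14–18: "since isotropic hulls are monomorphisms [Def. 1.3 (v)(a)],
this implies [by relating an arbitrary `φ ∈ Arr(C)` to the result of applying the isotropification
functor of Proposition 1.9, (v), to `φ`] that the assignment `φ ↦ Ψ(φ)` is compatible with composites,
for arbitrary `φ ∈ Arr(C)`"); together with `Ψ(id) = id`.
[cite: MochizukiFrdI2008, Prop. 2.5(iii) p.50] -/
def PsiComp (τ : CharacteristicSplitting F) (d : ℕ+) : Prop :=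
  Setting F →
    (∀ A : C, IsPsiValue τ d (𝟙 A) (𝟙 A)) ∧
      ∀ ⦃X Y Z : C⦄ (φ : X ⟶ Y) (ψ : Y ⟶ Z) (φ' : X ⟶ Y) (ψ' : Y ⟶ Z),
        IsPsiValue τ d φ φ' → IsPsiValue τ d ψ ψ' → IsPsiValue τ d (φ ≫ ψ) (φ' ≫ ψ')

/-! ## P25-L07 – L09 — the functor `Ψ : C ⥲ C(d)` (p. 49 ll. 1–8; p. 50 ll. 18–22) -/

/-- **P25-L07** `PsiUnitLinearData` (p. 50 ll. 18–20: "this completes the definition of a functor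
`Ψ : C → C(d)` which satisfies the properties (a), (b)"): there is a `UnitLinearFrobeniusData` for
"multiplication by `d`" whose action on arrows is the `Ψ`-value ((a): identity on objects — built into
the structure — and on isometries; membership `Div(Ψ φ) ∈ d · Φ`), which is (b) `1`-compatible,
relative to `C → F_Φ` and `C(d) → F_{d·Φ} ⊆ F_Φ`, with the Frobenius functor associated to `d` on `F_Φ`.
[cite: MochizukiFrdI2008, Prop. 2.5(iii) p.49] -/
def PsiUnitLinearData (τ : CharacteristicSplitting F) (d : ℕ+) : Prop :=
  Setting F → ∃ U : UnitLinearFrobeniusData F (powEnd Φ d),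
    (∀ ⦃A B : C⦄ (φ : A ⟶ B), IsPsiValue τ d φ (U.map φ)) ∧
      OneCommutes U.functor (wideSubcategoryInclusion (divIn F (powEnd Φ d)) ⋙ F) F
        (ElemFrobenioid.frobenius Φ d)

/-- **P25-L08** `PsiEquivalence` (p. 50 ll. 20–22: "it is clear from the definition of `Ψ`, `C(d)` that
`Ψ` is essentially surjective, faithful, and full [cf. assertion (i)]"): every `UnitLinearFrobeniusData`
realising the `Ψ`-values is an equivalence `C ⥲ C(d)`.
[cite: MochizukiFrdI2008, Prop. 2.5(iii) p.50] -/
def PsiEquivalence (τ : CharacteristicSplitting F) (d : ℕ+) : Prop :=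
  Setting F → ∀ U : UnitLinearFrobeniusData F (powEnd Φ d),
    (∀ ⦃A B : C⦄ (φ : A ⟶ B), IsPsiValue τ d φ (U.map φ)) → U.functor.IsEquivalence

/-- **P25-L09** `CdFrobenioid` (p. 49 ll. 7–8: "[which implies, in particular, that `C(d)`, equipped
with the natural functor `C(d) → F_{d·Φ}`, is a Frobenioid]"): transport of the Frobenioid structure of
`C → F_Φ` along an equivalence `C ⥲ C(d)` lying over the Frobenius functor "multiplication by `d`"
(an isomorphism `Φ ⥲ d · Φ` of divisor monoids). [cite: MochizukiFrdI2008, Prop. 2.5(iii) p.49] -/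
def CdFrobenioid (d : ℕ+) : Prop :=
  Setting F → ∀ U : UnitLinearFrobeniusData F (powEnd Φ d), U.functor.IsEquivalence →
    OneCommutes U.functor (wideSubcategoryInclusion (divIn F (powEnd Φ d)) ⋙ F) F
      (ElemFrobenioid.frobenius Φ d) →
    IsFrobenioid (cdToElem F (powEnd Φ d))

/-- **P25-L00** `Assembly25iii`: rows L07 + L08 give the landed target
`PreFrobenioid.UnitLinearFrobeniusExists d`, and with L09 the bracket `PreFrobenioid.CdIsFrobenioid d`
(PROVED assembly, no mathematical content). [cite: MochizukiFrdI2008, Prop. 2.5(iii) p.49] -/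
theorem assembly25iii (d : ℕ+) (h7 : ∀ τ : CharacteristicSplitting F, PsiUnitLinearData F τ d)
    (h8 : ∀ τ : CharacteristicSplitting F, PsiEquivalence F τ d) (h9 : CdFrobenioid F d) :
    UnitLinearFrobeniusExists F d ∧ CdIsFrobenioid F d := by
  refine ⟨fun τ hF hn hm ha => ?_, fun τ hF hn hm ha => ?_⟩
  · obtain ⟨U, hU, hc⟩ := h7 τ ⟨hF, hn, hm, ha⟩
    exact ⟨U, h8 τ ⟨hF, hn, hm, ha⟩ U hU, hc⟩
  · obtain ⟨U, hU, hc⟩ := h7 τ ⟨hF, hn, hm, ha⟩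
    exact h9 ⟨hF, hn, hm, ha⟩ U (h8 τ ⟨hF, hn, hm, ha⟩ U hU) hc

/-! ## Corollary 2.6 — the unit-wise Frobenius functor `Ψ := Ψ₂ ∘ Ψ₁` (p. 51 ll. 5–17) -/

/-- **C26-L01** `NaiveFactorsThroughCd` (p. 51 ll. 5–7: "the naive Frobenius functor `C → C` associated
to `d` [cf. Proposition 2.1, (i)] factors naturally through the subcategory `C(d) ⊆ C` [cf. Proposition
2.1, (ii); Definition 2.4, (iii)]; write `Ψ₁ : C → C(d)` for the resulting functor"), for the naive
Frobenius functor `naiveFrobeniusOf hF d` of the tree. [cite: MochizukiFrdI2008, Cor. 2.6 p.51] -/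
def NaiveFactorsThroughCd (d : ℕ+) : Prop :=
  ∀ hF : IsFrobenioid F, ∃ Ψ₁ : C ⥤ Cd F (powEnd Φ d),
    Ψ₁ ⋙ wideSubcategoryInclusion (divIn F (powEnd Φ d)) = naiveFrobeniusOf hF d

variable {F} in
/-- The data of Cor. 2.6's construction (p. 51 ll. 5–9): `Ψ₁ : C → C(d)` a factorisation of the naive
Frobenius functor through `C(d)`, and `U` a unit-linear Frobenius datum realising the `Ψ`-values of
Prop. 2.5 (iii) whose functor `Ψ_U : C → C(d)` is an equivalence; the unit-wise Frobenius functor is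
`Ψ := Ψ₂ ∘ Ψ₁` with `Ψ₂ = Ψ_U⁻¹` "some quasi-inverse". [cite: MochizukiFrdI2008, Cor. 2.6 p.51] -/
structure Cor26Data (τ : CharacteristicSplitting F) (d : ℕ+) (hF : IsFrobenioid F) where
  /-- `Ψ₁ : C → C(d)` -/
  Ψ₁ : C ⥤ Cd F (powEnd Φ d)
  /-- `Ψ₁` followed by `C(d) ⊆ C` is the naive Frobenius functor -/
  Ψ₁_spec : Ψ₁ ⋙ wideSubcategoryInclusion (divIn F (powEnd Φ d)) = naiveFrobeniusOf hF d
  /-- the unit-linear Frobenius datum -/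
  U : UnitLinearFrobeniusData F (powEnd Φ d)
  /-- its action on arrows is the `Ψ`-value of Prop. 2.5 (iii) -/
  U_spec : ∀ ⦃A B : C⦄ (φ : A ⟶ B), IsPsiValue τ d φ (U.map φ)
  /-- `Ψ_U : C → C(d)` is an equivalence (Prop. 2.5 (iii)) -/
  isEquivalence : U.functor.IsEquivalence

variable {F} in
/-- The unit-wise Frobenius functor `Ψ := Ψ₂ ∘ Ψ₁ : C → C` of the data (`Ψ₂ = Ψ_U⁻¹`).
[cite: MochizukiFrdI2008, Cor. 2.6 p.51] -/
def Cor26Data.psi {τ : CharacteristicSplitting F} {d : ℕ+} {hF : IsFrobenioid F}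
    (Δ : Cor26Data τ d hF) : C ⥤ C :=
  haveI := Δ.isEquivalence
  Δ.Ψ₁ ⋙ Δ.U.functor.inv

/-- **C26-L02** `UnitWise_a` (Cor. 2.6 (a), p. 50 ll. 34–35; proof p. 51 ll. 9–10: "it follows
immediately from Propositions 2.1, (ii); 2.5, (iii), (b), that `Ψ` satisfies property (a)"): `Ψ` is
`1`-compatible, relative to `C → F_Φ`, with the identity functor on `F_Φ`.
[cite: MochizukiFrdI2008, Cor. 2.6 p.50] -/
def UnitWise_a (τ : CharacteristicSplitting F) (d : ℕ+) : Prop :=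
  Setting F → ∀ (hF : IsFrobenioid F) (Δ : Cor26Data τ d hF),
    OneCommutes Δ.psi F F (𝟭 (ElemFrobenioid Φ))

/-- **C26-L03** `UnitWise_b` (Cor. 2.6 (b), p. 50 ll. 36–39; proof p. 51 ll. 10–14: "since [Prop. 2.5
(ii)] the isomorphism class of an object of `C^istr` is completely determined by the isomorphism class
of `D` to which it projects, … `Ψ` preserves isomorphism classes of objects of `C^istr`.  Now the
remainder of (b) … follows from the construction of `Ψ₁`, `Ψ₂` …"): `Ψ` maps an object (resp. a
morphism of Frobenius type; a pre-step; a pull-back morphism) of `C^istr` to an isomorphic object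
(resp. an abstractly equivalent morphism) of `C`. [cite: MochizukiFrdI2008, Cor. 2.6 p.50] -/
def UnitWise_b (τ : CharacteristicSplitting F) (d : ℕ+) : Prop :=
  Setting F → ∀ (hF : IsFrobenioid F) (Δ : Cor26Data τ d hF),
    (∀ A : C, IsIsotropic F A → Nonempty (Δ.psi.obj A ≅ A)) ∧
      ∀ ⦃A B : C⦄ (φ : A ⟶ B), IsIsotropic F A → IsIsotropic F B →
        (IsFrobeniusType F φ ∨ IsPreStep F φ ∨ IsPullbackMorphism F φ) →
          IsAbstractlyEquivalent (Δ.psi.map φ) φ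

/-- **C26-L04** `UnitWise_c` (Cor. 2.6 (c), p. 50 ll. 40–43; proof p. 51 ll. 14–17): for `A ∈ Ob(C^istr)`
there is an isomorphism `Ψ(A) ≅ A` conjugating the endomorphism of `O^×(A)` induced by `Ψ` into raising
to the `d`-th power. [cite: MochizukiFrdI2008, Cor. 2.6 p.50] -/
def UnitWise_c (τ : CharacteristicSplitting F) (d : ℕ+) : Prop :=
  Setting F → ∀ (hF : IsFrobenioid F) (Δ : Cor26Data τ d hF) (A : C), IsIsotropic F A →
    ∃ e : Δ.psi.obj A ≅ A, ∀ u ∈ unitsSubgroup F A,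
      e.inv ≫ Δ.psi.map u.hom ≫ e.hom = (u ^ (d : ℕ)).hom

/-- **C26-L05** `UnitWise_d` (Cor. 2.6 (d), p. 51 ll. 1–4, proof ll. 14–17 [Prop. 2.1 (iii);
Rem. 2.5.1]): if `C` is of perfect type then `Ψ` is an equivalence; if `d = 1` or `C` is of isotropic
and unit-trivial type then `Ψ` is isomorphic to the identity functor.
[cite: MochizukiFrdI2008, Cor. 2.6 p.51] -/
def UnitWise_d (τ : CharacteristicSplitting F) (d : ℕ+) : Prop :=
  Setting F → ∀ (hF : IsFrobenioid F) (Δ : Cor26Data τ d hF),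
    (IsOfPerfectType F → Δ.psi.IsEquivalence) ∧
      ((d = 1 ∨ (IsOfIsotropicType F ∧ IsOfType (IsUnitTrivial F))) → Nonempty (Δ.psi ≅ 𝟭 C))

/-- **C26-L00** `Assembly26`: rows C26-L01 (existence of `Ψ₁`), P25-L07/L08 (existence of `U`) and
C26-L02 – L05 give the landed target `PreFrobenioid.UnitWiseFrobeniusExists d` (PROVED assembly).
[cite: MochizukiFrdI2008, Cor. 2.6 p.50] -/
theorem assembly26 (d : ℕ+) (h1 : NaiveFactorsThroughCd F d)
    (h7 : ∀ τ : CharacteristicSplitting F, PsiUnitLinearData F τ d)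
    (h8 : ∀ τ : CharacteristicSplitting F, PsiEquivalence F τ d)
    (ha : ∀ τ : CharacteristicSplitting F, UnitWise_a F τ d)
    (hb : ∀ τ : CharacteristicSplitting F, UnitWise_b F τ d)
    (hc : ∀ τ : CharacteristicSplitting F, UnitWise_c F τ d)
    (hd : ∀ τ : CharacteristicSplitting F, UnitWise_d F τ d) : UnitWiseFrobeniusExists F d := by
  intro τ hF hn hm hA
  have hS : Setting F := ⟨hF, hn, hm, hA⟩
  obtain ⟨Ψ₁, hΨ₁⟩ := h1 hF
  obtain ⟨U, hU, -⟩ := h7 τ hS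
  let Δ : Cor26Data τ d hF := ⟨Ψ₁, hΨ₁, U, hU, h8 τ hS U hU⟩
  refine ⟨Δ.psi, ha τ hS hF Δ, (hb τ hS hF Δ).1, ?_, hc τ hS hF Δ, (hd τ hS hF Δ).1, (hd τ hS hF Δ).2⟩
  intro A B φ hAi hBi hφ
  exact (hb τ hS hF Δ).2 φ hAi hBi hφ

end FrdI.P25

end Literature.AlgebraicGeometry.Frobenioids

end
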